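import Summits.KontsevichZagierPeriods.KontsevichZagierPeriods.Theorems.ValuedFieldSpecialisationParametricLiftingGradedBootstrap

/-!
# Route ValuedFieldSpecialisation — crux `ParametricLifting` (stmt-KontsevichZagierPeriods-3498):
# the level-wise induction step of the graded bootstrap with GRADED hypotheses (lead c9, sub-goal W6)

Helper (`--supports stmt-KontsevichZagierPeriods-3498`) for line `registered`. Write level `E` :=
`AddSubgroup.closure {[r] | dim r < E}` ⊆ `KZ.FormalRep` and

* **KL(`E`)** := every `x` on level `E` with `KZ.eval x = 0` lies in `KZ.relations` (the kernel conjecture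
  on level `E`);
* **RLG′(`E`)** := the graded regularised lifting of the c7 bootstrap
  (`…ParametricLiftingGradedBootstrap.lean`: every value-`0` element of level `E` is, up to a relation, the
  special fibre of a fibred relation `H = Σ mᵢ [Pᵢ] + Σ m₂ⱼ [Rⱼ]` whose divergent part is ELEMENTARY with
  coefficient representations `ρᵢ` of dimension `dᵢ`, `dᵢ + 1 < E`, and whose `Rⱼ` are DOMINATED with special
  fibres `r₀ⱼ`) with ONE extra clause: the dominated fibres have dimension `d₂ j < E`, i.e. the certifying
  net itself lives on level `E`;
* **SFG(`E`)** := graded special-fibre rigidity: special-fibre classes of dominated fibred relations with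
  fibres of dimension `< E` are relations.

This file: `stub_kernelLevel_succ_of_graded` — **KL(`E`) → RLG′(`E + 1`) → SFG(`E + 1`) → KL(`E + 1`)**,
the `succ` branch of `kzKernel_dimLevel_of_regLiftGraded_of_specialFibre` restated with level-wise
hypotheses: KL(`E`) replaces the induction hypothesis, RLG′(`E + 1`) the global RLG, SFG(`E + 1`) the
global SF. Proof (verbatim the c7 step): the slices of the divergent part vanish
(`stub_divergentNetVanishes_of` with `stub_sliceValue_elementaryFamily`,
`stub_divergentMonomials_coeff_eq_zero`); its coefficient classes have value `0`
(`stub_eval_coefficientClass_eq_zero`) and live on level `E`, so are relations by KL(`E`); the divergent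
part is then a fibred relation (`stub_elementaryNet_mem_fibredRelations`), hence so is the dominated net
`N = H − D`, whose fibres have dimension `< E + 1`, and SFG(`E + 1`) certifies its special fibre `≡ x`.

Sources: M. Kontsevich, D. Zagier, *Periods* (2001), §1.2, Conjecture 1 (the kernel conjecture being
graded); K. Ihara, M. Kaneko, D. Zagier, *Derivation and double shuffle relations for multiple zeta
values*, Compos. Math. 142 (2006) (the weight drop of regularised double shuffle — the model for the
grading clause `dᵢ + 1 < E`). The fibred / dominated / elementary vocabulary is this route's
(`KZFibredRelations.lean`, `KZDominatedFamily.lean`). No definitions.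
-/

noncomputable section

namespace Summit.KontsevichZagierPeriods.ValuedFieldSpecialisation

open MeasureTheory Set Filter
open scoped Topology
open Literature.NumberTheory.Transcendental

/-- **KL(`E`) → RLG′(`E + 1`) → SFG(`E + 1`) → KL(`E + 1`)** (lead c9 sub-goal W6): the level-wise
induction step of the graded bootstrap. Given the kernel conjecture on level `E`, the fibre-graded
regularised lifting on level `E + 1` and graded special-fibre rigidity for fibres of dimension `< E + 1`,
every value-`0` formal combination on level `E + 1` is a relation: the slices of the elementary divergent
part of the certifying net vanish (`stub_divergentNetVanishes_of`), its coefficient classes have value `0`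
(`stub_eval_coefficientClass_eq_zero`) on level `E` and so are relations by KL(`E`), the divergent part is a
fibred relation (`stub_elementaryNet_mem_fibredRelations`), hence so is the dominated net `H − D`, and the
graded rigidity (its fibres have dimension `d₂ j < E + 1`) makes its special fibre, `≡ x`, a relation.
[cite: KontsevichZagier2001, §1.2 Conjecture 1] -/
theorem stub_kernelLevel_succ_of_graded : ∀ (E : ℕ), (∀ (x : KZ.FormalRep), x ∈ AddSubgroup.closure {y : KZ.FormalRep | ∃ (n : ℕ) (r : KZ.IntegralRep n), n < E ∧ y = KZ.of r} → KZ.eval x = 0 → x ∈ KZ.relations) → (∀ (x : KZ.FormalRep), x ∈ AddSubgroup.closure {y : KZ.FormalRep | ∃ (n : ℕ) (r : KZ.IntegralRep n), n < E + 1 ∧ y = KZ.of r} → KZ.eval x = 0 → ∃ H ∈ KZ.fibredRelations, ∃ (k : ℕ) (m : Fin k → ℤ) (p q b d : Fin k → ℕ) (ρ : (i : Fin k) → KZ.IntegralRep (d i)) (P : (i : Fin k) → KZ.IntegralRep (b i + d i + 1 + 1)) (k₂ : ℕ) (d₂ : Fin k₂ → ℕ) (m₂ : Fin k₂ → ℤ)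 (R : (j : Fin k₂) → KZ.IntegralRep (d₂ j + 1)) (r₀ g : (j : Fin k₂) → KZ.IntegralRep (d₂ j)), (∀ i, 0 < q i ∧ p i < q i ∧ (0 < p i ∨ 0 < b i) ∧ d i + 1 < E + 1 ∧ (P i).domain = {z | ∃ (s u : ℝ) (y : Fin (b i) → ℝ) (w : Fin (d i) → ℝ), z = Matrix.vecCons s (Matrix.vecCons u (Fin.append y w)) ∧ 0 < s ∧ s < 1 ∧ 0 < u ∧ u ^ (q i) * s ^ (p i) < 1 ∧ (∀ j, s ≤ y j ∧ y j ≤ 1) ∧ w ∈ (ρ i).domain} ∧ (P i).integrand = fun z => (∏ j : Fin (b i), (z (Fin.castAdd (d i) j).succ.succ)⁻¹) * (ρ i).integrand (fun l : Fin (d i) => z (Fin.natAdd (b i) l).succ.succ)) ∧ (∀ j, d₂ j < E + 1 ∧ KZ.IsDominatedFamily (R j) (r₀ j) (g j)) ∧ H = (∑ i, m i • KZ.of (P i)) + (∑ j, m₂ j • KZ.of (R j)) ∧ (∑ j, m₂ j • KZ.of (r₀ j)) - x ∈ KZ.relations) → (∀ (k : ℕ) (d : Fin k → ℕ) (m : Fin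 k → ℤ) (R : (i : Fin k) → KZ.IntegralRep (d i + 1)) (r₀ g : (i : Fin k) → KZ.IntegralRep (d i)), (∀ i, d i < E + 1) → (∀ i, KZ.IsDominatedFamily (R i) (r₀ i) (g i)) → (∑ i, m i • KZ.of (R i)) ∈ KZ.fibredRelations → (∑ i, m i • KZ.of (r₀ i)) ∈ KZ.relations) → (∀ (x : KZ.FormalRep), x ∈ AddSubgroup.closure {y : KZ.FormalRep | ∃ (n : ℕ) (r : KZ.IntegralRep n), n < E + 1 ∧ y = KZ.of r} → KZ.eval x = 0 → x ∈ KZ.relations) := by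
  intro E ih hRL hSF x hx hx0
  obtain ⟨H, hH, k, m, p, q, b, d, ρ, P, k₂, d₂, m₂, R, r₀, g, hP, hR, hHeq, hfib⟩ := hRL x hx hx0
  -- the elementary clauses without the grading
  have hP' : ∀ i, 0 < q i ∧ p i < q i ∧ (0 < p i ∨ 0 < b i) ∧ (P i).domain = {z | ∃ (s u : ℝ) (y : Fin (b i) → ℝ) (w : Fin (d i) → ℝ), z = Matrix.vecCons s (Matrix.vecCons u (Fin.append y w)) ∧ 0 < s ∧ s < 1 ∧ 0 < u ∧ u ^ (q i) * s ^ (p i) < 1 ∧ (∀ j, s ≤ y j ∧ y j ≤ 1) ∧ w ∈ (ρ i).domain} ∧ (P i).integrand = fun z => (∏ j : Fin (b i), (z (Fin.castAdd (d i) j).succ.succ)⁻¹) * (ρ i).integrand (fun l : Fin (d i) => z (Fin.natAdd (b i) l).succ.succ) :=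
    fun i => ⟨(hP i).1, (hP i).2.1, (hP i).2.2.1, (hP i).2.2.2.2⟩
  -- S2: the slices of the divergent part vanish identically on `(0,1)`
  have hvan : ∀ s ∈ Set.Ioo (0 : ℝ) 1, KZ.sliceEval (∑ i, m i • KZ.of (P i)) s = 0 :=
    stub_divergentNetVanishes_of stub_sliceValue_elementaryFamily stub_divergentMonomials_coeff_eq_zero
      H hH k m p q b d ρ P k₂ d₂ m₂ R r₀ g (fun i => ⟨(hP i).1, (hP i).2.2.1, (hP i).2.2.2.2⟩)
      (fun j => (hR j).2) hHeq
  -- the coefficient classes have value zero and live on level `E`: relations by KL(`E`)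
  have hcoef : ∀ i₀ : Fin k, (∑ i ∈ Finset.univ.filter
      (fun i => (p i / q i : ℝ) = (p i₀ / q i₀ : ℝ) ∧ b i = b i₀), m i • KZ.of (ρ i)) ∈ KZ.relations := by
    intro i₀
    refine ih _ ?_ (stub_eval_coefficientClass_eq_zero k m p q b d ρ P hP' hvan i₀)
    refine AddSubgroup.sum_mem _ fun i _ => AddSubgroup.zsmul_mem _ (AddSubgroup.subset_closure ?_) _
    exact ⟨d i, ρ i, by have := (hP i).2.2.2.1; omega, rfl⟩
  -- S3a: the divergent part is a fibred relation
  have hD : (∑ i, m i • KZ.of (P i)) ∈ KZ.fibredRelations :=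
    stub_elementaryNet_mem_fibredRelations k m p q b d ρ P hP' hcoef
  -- hence so is the dominated net `N = H - D`
  have hN : (∑ j, m₂ j • KZ.of (R j)) ∈ KZ.fibredRelations := by
    have hEq : (∑ j, m₂ j • KZ.of (R j)) = H - ∑ i, m i • KZ.of (P i) := by
      rw [hHeq]; abel
    rw [hEq]
    exact KZ.fibredRelations.sub_mem hH hD
  -- SFG(`E + 1`): the fibres of `N` have dimension `< E + 1`, so its special-fibre class is a relation,
  -- and it is `≡ x`
  have h := KZ.relations.sub_mem (hSF k₂ d₂ m₂ R r₀ g (fun j => (hR j).1) (fun j => (hR j).2) hN) hfib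
  rwa [sub_sub_cancel] at h

end Summit.KontsevichZagierPeriods.ValuedFieldSpecialisation
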